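import Summits.BirchSwinnertonDyer.BirchSwinnertonDyer.Theorems.RamifiedSevenEllipticUnitsStrictControlAnyPrime
import Summits.BirchSwinnertonDyer.BirchSwinnertonDyer.Theorems.RamifiedSevenEllipticUnitsKummerPlusMinusChart
import Summits.BirchSwinnertonDyer.Rank1Residual.X11b.ZpLineIndex
import Literature.NumberTheory.EllipticCurves.BSDQuadraticDescentTorsionOddPartProofs
import Literature.NumberTheory.EllipticCurves.VariableChangePointsMap
import HarnessLib

/-!
# K7r crux `EllipticUnitValueSeven` (stmt-BirchSwinnertonDyer-19705), line `rubin-formula`, stub S_dict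
# `stub_localMordellWeilDictSeven`: COMPATIBILITIES for the `±`-chart of `E(K_𝔭)` at an O11 frame —
# curve identities and coordinate computations (cell `bsd-cm`, seat `bsd-cm-k7r-c3` g6; helper file,
# `--supports` 19705; consumed by `RamifiedSevenEllipticUnitsKummerFrameChart.lean`)

HONEST FRAMING. Nothing is asserted about the crux; BSD is not proved by any of this; a closed item
closes a rung leaf of BirchSwinnertonDyer at most. This is the elliptic-curve plumbing of the local
Mordell–Weil dictionary S_dict (`m_loc = n + n'`): at an O11 frame `(K, 𝔭, W', C)` of `(W, p)`
(`X12.O11.IsFrame`: `W` CM, `p ≥ 5` ramified in the CM field `K = ℚ(√−p)`, `𝔭 ∣ p`, `W' = C • W^{(−p)}`)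
the sequel file constructs (`exists_frameChart`) an additive CHART

  `Φ : E(K_𝔭) = (W_K ⊗ K_𝔭)(K_𝔭) → ℤ_p × ℤ_p`, kernel = torsion, ONTO,

together with the charts `λ = Ψ : E(ℚ_p) → ℤ_p`, `λ' : E'(ℚ_p) → ℤ_p` of the tree's `X11b.LocalIndex.psi`
(AEC VII.6.3; torsion kernel; onto because `E(ℚ_p)[p] = 0 = E'(ℚ_p)[p]` at a frame), such that
(V1) `Φ(P) = (λ(P), 0)` for `P ∈ E(ℚ)`, (V2) every `P' ∈ E'(ℚ)` has a twist `T ∈ E(K)` with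
`Φ(T) = (0, λ'(P'))`, (V3) for every `R ∈ E(K)` there are `Q ∈ E(ℚ)`, `Q' ∈ E'(ℚ)` with
`Φ(R) = (u λ(Q), u λ'(Q'))`, `2u = 1` — the GLOBAL quadratic descent `2E(K) ⊆ E(ℚ) + τ E'(ℚ)`.
Construction: `K_𝔭 = F(θ)`, `F = ℚ_v ≅ ℚ_p` (`v = (p)`), `θ = √−p ∉ F`, `[K_𝔭 : F] = 2` (as in k7r-c4's
`noPTorsion_adicCompletion_of_isFrame`); the tree's quadratic descent (`QuadraticDescent.incl`,
`twistMap`, `conjMap`; Silverman Ex. 10.16) on the completed-square model over `F` and over `ℚ`, fed to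
the abstract `±`-chart `KummerCore.exists_plusMinusChart`; transport along the changes of variables
(`VariableChange.pointEquivBaseChange`, functorial in the field). THIS FILE holds the ingredients
that are not specific to the frame: §1 the matching of the two conjugations (`K = ℚ(θ₁) → L = F(θ)`),
§2 the curve identities (`(W^{(1)}) ⊗ L = ((W ⊗ F)^{(1)}) ⊗ L`, …; ring maps out of `ℚ` agree), §3 the
point-level compatibilities of the bridge `E^{(1)}(K) → E_F^{(1)}(L)` with `ι`, `τ`, `σ` and with the
rational changes of variables (coordinate computations).
References: J. H. Silverman, *AEC* (2009) X.2 Prop. 2.4, X.5 Cor. 5.4, Exercise 10.16, Prop. VII.6.3;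
cell memo `STUB-PLAN-stub_localMordellWeilDictSeven.md` (L3–L5).
-/

set_option linter.dupNamespace false

noncomputable section

open scoped Classical

open WeierstrassCurve NumberField IsDedekindDomain Field
  Literature.NumberTheory.EllipticCurves Literature.NumberTheory.QuadraticFields
  Literature.NumberTheory.EllipticCurves.Rank1Residual
  WeierstrassCurve.QuadraticDescent
  Summit.BirchSwinnertonDyer.Rank1Residual

namespace Summit.BirchSwinnertonDyer.BirchSwinnertonDyer.Theorems.RamifiedSevenEllipticUnits.KummerCore

/-! ## §1 Two quadratic extensions `K = ℚ(θ₁) ⊆ L = F(θ)` with matching conjugations -/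

/-- **The conjugations match.** Let `K = ℚ(θ₁)` (`[K:ℚ] = 2`, `θ₁ ∉ ℚ`, `θ₁² = c`) and `L = F(θ)`
(`[L:F] = 2`, `θ ∉ F`, `θ² = c'`), and `φ : K → L` a `ℚ`-algebra map with `φ θ₁ = θ`, `F` a `ℚ`-algebra.
Then `φ ∘ σ_K = σ_L ∘ φ` for the conjugations `σ` of the tree's `Quadratic.conj` (both are determined by
`θ ↦ −θ`; every element of `K` is `a + bθ₁`, `a, b ∈ ℚ`; ring maps out of `ℚ` are unique). [folklore] -/
theorem map_conj_eq_conj_map {K F L : Type*} [Field K] [Field F] [Field L] [Algebra ℚ K] [Algebra ℚ F]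
    [Algebra ℚ L] [Algebra F L] (h2K : Module.finrank ℚ K = 2) {θ₁ : K} {c : ℚ}
    (hθ₁ : θ₁ ∉ Set.range (algebraMap ℚ K)) (hc : θ₁ ^ 2 = algebraMap ℚ K c)
    (h2 : Module.finrank F L = 2) {θ : L} {c' : F} (hθ : θ ∉ Set.range (algebraMap F L))
    (hc' : θ ^ 2 = algebraMap F L c') (φ : K →ₐ[ℚ] L) (hφ : φ θ₁ = θ) (z : K) :
    φ (Quadratic.conj h2K hθ₁ hc z) = Quadratic.conj h2 hθ hc' (φ z) := by
  obtain ⟨a, b, rfl⟩ := Quadratic.exists_eq_add_mul h2K hθ₁ z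
  have hcast : ∀ q : ℚ, φ (algebraMap ℚ K q) = algebraMap F L (algebraMap ℚ F q) := fun q ↦ by
    rw [AlgHom.commutes]
    exact RingHom.congr_fun (Subsingleton.elim (algebraMap ℚ L)
      ((algebraMap F L).comp (algebraMap ℚ F))) q
  rw [Quadratic.conj_add_mul, map_sub, map_add, map_mul, hφ, hcast, hcast, Quadratic.conj_add_mul]

/-! ## §2 Curve identities at a frame: the completed square and the twist over `F` and over `L` -/

section Curves

variable (W : WeierstrassCurve ℚ) {F L : Type*} [Field F] [Field L] [Algebra ℚ F] [Algebra ℚ L]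
  [Algebra F L]

/-- `(W^{(d)}) ⊗ F = (W ⊗ F)^{(d)}` (`map_quadraticTwist`). [cite: SilvermanAEC2009, X.5 Cor. 5.4] -/
theorem baseChange_quadraticTwist (d : ℚ) :
    (W.quadraticTwist d).baseChange F = (W.baseChange F).quadraticTwist (algebraMap ℚ F d) := by
  rw [baseChange, baseChange, map_quadraticTwist]

/-- `(W^{(1)}) ⊗ F = (W ⊗ F)^{(1)}`. [cite: SilvermanAEC2009, X.5 Cor. 5.4] -/
theorem baseChange_quadraticTwist_one :
    (W.quadraticTwist 1).baseChange F = (W.baseChange F).quadraticTwist 1 := by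
  rw [baseChange_quadraticTwist, map_one]

/-- `(W^{(−p)}) ⊗ F = (W ⊗ F)^{(−p)}`. [cite: SilvermanAEC2009, X.5 Cor. 5.4] -/
theorem baseChange_quadraticTwist_neg_natCast (p : ℕ) :
    (W.quadraticTwist (-(p : ℚ))).baseChange F = (W.baseChange F).quadraticTwist (-(p : F)) := by
  rw [baseChange_quadraticTwist, map_neg, map_natCast]

/-- `(W^{(1)}) ⊗ L = ((W ⊗ F)^{(1)}) ⊗ L` — the ambient curve of the local quadratic descent is the
base change of the global completed-square model (ring maps out of `ℚ` agree). [cite: SilvermanAEC2009, X.5 Cor. 5.4] -/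
theorem baseChange_quadraticTwist_one_eq_baseChange :
    (W.quadraticTwist 1).baseChange L = ((W.baseChange F).quadraticTwist 1).baseChange L := by
  rw [← baseChange_quadraticTwist_one, baseChange, baseChange, baseChange, map_map]
  congr 1
  exact Subsingleton.elim _ _

/-- `(W ⊗ K) ⊗ L = W ⊗ L` along any algebra map `K → L` (ring maps out of `ℚ` agree). [folklore] -/
theorem baseChange_baseChange {K : Type*} [Field K] [Algebra ℚ K] [Algebra K L] :
    (W.baseChange K).baseChange L = W.baseChange L := by
  rw [baseChange, baseChange, baseChange, map_map]
  congr 1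
  exact Subsingleton.elim _ _

/-- `(C • W) ⊗ F = (W^{(1)}) ⊗ F` for a change of variables with `C • W = W^{(1)}`. [folklore] -/
theorem baseChange_smul_eq_of_eq (C : VariableChange ℚ) (hC : C • W = W.quadraticTwist 1) :
    (C • W).baseChange F = (W.quadraticTwist 1).baseChange F := by
  rw [hC]

/-- The base-changed change of variables completes the square over `F`:
`C_F • (W ⊗ F) = (W ⊗ F)^{(1)}`. [folklore] -/
theorem map_smul_baseChange_eq (C : VariableChange ℚ) (hC : C • W = W.quadraticTwist 1) :
    C.map (algebraMap ℚ F) • W.baseChange F = (W.baseChange F).quadraticTwist 1 := by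
  rw [← VariableChange.baseChange_smul_eq, hC, baseChange_quadraticTwist_one]

end Curves

/-! ## §3 Point-level compatibilities (coordinates; the changes of variables are base changes of
rational ones, and ring maps out of `ℚ` agree) -/

section Points

variable {K F L : Type*} [Field K] [Field F] [Field L] [Algebra ℚ K] [Algebra ℚ F] [Algebra ℚ L]
  [Algebra F L] (W : WeierstrassCurve ℚ) (φ : K →ₐ[ℚ] L)

/-- Casts of rationals agree: `φ(q) = q` in `L`, computed through `F` (ring maps out of `ℚ` are
unique). [folklore] -/
theorem ratCast_compat (x : ℚ) : φ (algebraMap ℚ K x) = algebraMap F L (algebraMap ℚ F x) := by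
  rw [AlgHom.commutes]
  exact RingHom.congr_fun (Subsingleton.elim (algebraMap ℚ L)
    ((algebraMap F L).comp (algebraMap ℚ F))) x

/-- Transport along an equality of curves commutes with the maps on points induced by a field map.
[folklore] -/
theorem map_congrEquiv_baseChange {R F' K' L' : Type*} [CommRing R] [Field F'] [Field K'] [Field L']
    [Algebra R F'] [Algebra R K'] [Algebra F' K'] [IsScalarTower R F' K'] [Algebra R L'] [Algebra F' L']
    [IsScalarTower R F' L'] {V₁ V₂ : WeierstrassCurve R} (hV : V₁ = V₂) (f : K' →ₐ[F'] L')
    (P : (V₁.baseChange K').toAffine.Point) :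
    Affine.Point.map (W' := V₂) f
        (Affine.Point.congrEquiv (congrArg (fun V : WeierstrassCurve R ↦ V.baseChange K') hV) P) =
      Affine.Point.congrEquiv (congrArg (fun V : WeierstrassCurve R ↦ V.baseChange L') hV)
        (Affine.Point.map (W' := V₁) f P) := by
  subst hV
  rfl

/-- **Bridge ∘ conjugation = conjugation ∘ bridge.** The bridge `E^{(1)}(K) → E_F^{(1)}(L)` (map on
points along `φ : K → L`, then transport to the local completed-square model) intertwines the global
and local conjugations, provided `φ ∘ σ_K = σ_L ∘ φ` on `K`. [cite: SilvermanAEC2009, Exercise 10.16] -/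
theorem bridge_conjMap (h2K : Module.finrank ℚ K = 2) {θ₁ : K} {c : ℚ}
    (hθ₁ : θ₁ ∉ Set.range (algebraMap ℚ K)) (hc : θ₁ ^ 2 = algebraMap ℚ K c)
    (h2 : Module.finrank F L = 2) {θ : L} {c' : F} (hθ : θ ∉ Set.range (algebraMap F L))
    (hc' : θ ^ 2 = algebraMap F L c')
    (hcc : ∀ z : K, φ (Quadratic.conj h2K hθ₁ hc z) = Quadratic.conj h2 hθ hc' (φ z))
    (P : ((W.quadraticTwist 1).baseChange K).toAffine.Point) :
    Affine.Point.congrEquiv (baseChange_quadraticTwist_one_eq_baseChange W (F := F) (L := L))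
      (Affine.Point.map (W' := W.quadraticTwist 1) φ
        (conjMap (W.quadraticTwist 1) (Quadratic.conj h2K hθ₁ hc) P)) =
    conjMap ((W.baseChange F).quadraticTwist 1) (Quadratic.conj h2 hθ hc')
      (Affine.Point.congrEquiv (baseChange_quadraticTwist_one_eq_baseChange W (F := F) (L := L))
        (Affine.Point.map (W' := W.quadraticTwist 1) φ P)) := by
  rcases P with _ | ⟨x, y, h⟩
  · simp only [← Affine.Point.zero_def, map_zero]
  · simp only [conjMap, Affine.Point.map_some, Affine.Point.congrEquiv_some, hcc]

/-- **Bridge ∘ inclusion = inclusion ∘ base change.** For `Q ∈ E^{(1)}(ℚ)`: the bridge of `ι_K Q` is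
`ι_L` of the base change of `Q` to `F` (read on the local model). [cite: SilvermanAEC2009, Exercise 10.16] -/
theorem bridge_incl (Q : (W.quadraticTwist 1).toAffine.Point) :
    Affine.Point.congrEquiv (baseChange_quadraticTwist_one_eq_baseChange W (F := F) (L := L))
      (Affine.Point.map (W' := W.quadraticTwist 1) φ (incl K (W.quadraticTwist 1) Q)) =
    incl L ((W.baseChange F).quadraticTwist 1)
      (Affine.Point.congrEquiv (baseChange_quadraticTwist_one W (F := F))
        (Affine.Point.baseChange (W' := W.quadraticTwist 1) ℚ F Q)) := by
  rcases Q with _ | ⟨x, y, h⟩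
  · show Affine.Point.congrEquiv _ (Affine.Point.map (W' := W.quadraticTwist 1) φ
        (incl K (W.quadraticTwist 1) 0)) =
      incl L _ (Affine.Point.congrEquiv _ (Affine.Point.baseChange (W' := W.quadraticTwist 1) ℚ F 0))
    simp only [map_zero]
  · show Affine.Point.congrEquiv _ (.some (φ (algebraMap ℚ K x)) (φ (algebraMap ℚ K y)) _) =
      incl L _ (Affine.Point.congrEquiv _ (.some (algebraMap ℚ F x) (algebraMap ℚ F y) _))
    rw [Affine.Point.congrEquiv_some, Affine.Point.congrEquiv_some]
    show _ = Affine.Point.some (algebraMap F L (algebraMap ℚ F x))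
      (algebraMap F L (algebraMap ℚ F y)) _
    congr 1 <;> exact ratCast_compat (F := F) φ _

/-- **Bridge ∘ global twisting map = local twisting map ∘ base change** (`θ = φ θ₁`, `θ² = −p`): for
`R ∈ E^{(−p)}(ℚ)`, the bridge of `τ_K R` is `τ_L` of the base change of `R` to `F`.
[cite: SilvermanAEC2009, X.5 Cor. 5.4] -/
theorem bridge_twistMap [CharZero K] [CharZero F] (p : ℕ) {θ₁ : K}
    (hθ₁ : θ₁ ∉ Set.range (algebraMap ℚ K)) (hc₁ : θ₁ ^ 2 = algebraMap ℚ K (-(p : ℚ)))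
    {θ : L} (hθ : θ ∉ Set.range (algebraMap F L)) (hc : θ ^ 2 = algebraMap F L (-(p : F)))
    (hφθ : φ θ₁ = θ) (R : (W.quadraticTwist (-(p : ℚ))).toAffine.Point) :
    Affine.Point.congrEquiv (baseChange_quadraticTwist_one_eq_baseChange W (F := F) (L := L))
      (Affine.Point.map (W' := W.quadraticTwist 1) φ (twistMap W hθ₁ hc₁ R)) =
    twistMap (W.baseChange F) hθ hc
      (Affine.Point.congrEquiv (baseChange_quadraticTwist_neg_natCast W (F := F) p)
        (Affine.Point.baseChange (W' := W.quadraticTwist (-(p : ℚ))) ℚ F R)) := by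
  rcases R with _ | ⟨x, y, h⟩
  · show Affine.Point.congrEquiv _ (Affine.Point.map (W' := W.quadraticTwist 1) φ
        (twistMap W hθ₁ hc₁ 0)) =
      twistMap (W.baseChange F) hθ hc (Affine.Point.congrEquiv _
        (Affine.Point.baseChange (W' := W.quadraticTwist (-(p : ℚ))) ℚ F 0))
    simp only [map_zero]
  · obtain ⟨h₁, e₁⟩ := twistMap_some W hθ₁ hc₁ h
    rw [e₁]
    show Affine.Point.congrEquiv _ (.some (φ ((twistUntwist hθ₁).toX (algebraMap ℚ K x)))
        (φ ((twistUntwist hθ₁).toY (algebraMap ℚ K x) (algebraMap ℚ K y))) _) =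
      twistMap (W.baseChange F) hθ hc (Affine.Point.congrEquiv _
        (.some (algebraMap ℚ F x) (algebraMap ℚ F y) _))
    rw [Affine.Point.congrEquiv_some, Affine.Point.congrEquiv_some]
    have hF : ((W.baseChange F).quadraticTwist (-(p : F))).toAffine.Nonsingular (algebraMap ℚ F x)
        (algebraMap ℚ F y) := by
      rw [← baseChange_quadraticTwist_neg_natCast]
      exact (Affine.baseChange_nonsingular (W := W.quadraticTwist (-(p : ℚ))) (f := Algebra.ofId ℚ F)
        (algebraMap ℚ F).injective x y).mpr h
    obtain ⟨h₂, e₂⟩ := twistMap_some (W.baseChange F) hθ hc hF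
    rw [e₂]
    congr 1
    · simp only [VariableChange.toX_def, twistUntwist, sub_zero, map_mul, map_pow, map_inv₀,
        Units.val_inv_eq_inv_val, Units.val_mk0, hφθ, ratCast_compat (F := F) φ]
    · simp only [VariableChange.toY_def, twistUntwist, sub_zero, zero_mul, map_mul, map_pow, map_inv₀,
        Units.val_inv_eq_inv_val, Units.val_mk0, hφθ, ratCast_compat (F := F) φ]

/-- Transport to `W ⊗ L` of the base change `E(K) → (W_K ⊗ L)(L)` is the map on points along
`φ = (K → L)`. [folklore] -/
theorem congrEquiv_baseChange_baseChange [Algebra K L] (hKL : (W.baseChange K).baseChange L = W.baseChange L)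
    (hφ : ∀ z, φ z = algebraMap K L z) (R : (W.baseChange K).toAffine.Point) :
    Affine.Point.congrEquiv hKL (Affine.Point.baseChange (W' := W.baseChange K) K L R) =
      Affine.Point.map (W' := W) φ R := by
  rcases R with _ | ⟨x, y, h⟩
  · show Affine.Point.congrEquiv hKL (Affine.Point.baseChange (W' := W.baseChange K) K L 0) =
      Affine.Point.map (W' := W) φ 0
    simp only [map_zero]
  · show Affine.Point.congrEquiv _ (.some (algebraMap K L x) (algebraMap K L y) _) =
      .some (φ x) (φ y) _
    rw [Affine.Point.congrEquiv_some]
    congr 1 <;> exact (hφ _).symm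

/-- For `Q ∈ E(ℚ)`, the completed-square coordinates of `Q` read in `K` are `ι_K` of the
completed-square coordinates of `Q` (the change of variables is defined over `ℚ`). [folklore] -/
theorem congrEquiv_pointEquivBaseChange_baseChange (C₀ : VariableChange ℚ)
    (hC₀ : C₀ • W = W.quadraticTwist 1) (Q : W.toAffine.Point) :
    Affine.Point.congrEquiv (congrArg (fun V : WeierstrassCurve ℚ ↦ V.baseChange K) hC₀)
        (VariableChange.pointEquivBaseChange W C₀ K (Affine.Point.baseChange (W' := W) ℚ K Q)) =
      incl K (W.quadraticTwist 1) (Affine.Point.congrEquiv hC₀ (VariableChange.pointEquiv W C₀ Q)) := by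
  rcases Q with _ | ⟨x, y, h⟩
  · show Affine.Point.congrEquiv _ (VariableChange.pointEquivBaseChange W C₀ K
        (Affine.Point.baseChange (W' := W) ℚ K 0)) =
      incl K _ (Affine.Point.congrEquiv hC₀ (VariableChange.pointEquiv W C₀ 0))
    simp only [map_zero]
  · show Affine.Point.congrEquiv _ (VariableChange.pointEquivBaseChange W C₀ K
        (.some (algebraMap ℚ K x) (algebraMap ℚ K y) _)) =
      incl K _ (Affine.Point.congrEquiv _ (VariableChange.pointEquiv W C₀ (.some x y h)))
    rw [VariableChange.pointEquivBaseChange_some, Affine.Point.congrEquiv_some,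
      VariableChange.pointEquiv_some, Affine.Point.congrEquiv_some]
    show _ = Affine.Point.some (algebraMap ℚ K (C₀.toX x)) (algebraMap ℚ K (C₀.toY x y)) _
    congr 1
    · simp only [VariableChange.toX_def, VariableChange.map, map_mul, map_pow, map_sub,
        Units.coe_map_inv, MonoidHom.coe_coe]
    · simp only [VariableChange.toY_def, VariableChange.map, map_mul, map_pow, map_sub,
        Units.coe_map_inv, MonoidHom.coe_coe]

/-- **Base change commutes with rational changes of variables, across models**: for `C • V₁ = V₂`
over `ℚ`, `F`-models `U₁ = V₁ ⊗ F`, `U₂ = V₂ ⊗ F = C_F • U₁`, and `Q ∈ V₁(ℚ)`: applying `C_F` to the base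
change of `Q` gives the base change of `C • Q`. [cite: SilvermanAEC2009, III.3.1(b)] -/
theorem congrEquiv_pointEquiv_baseChange {V₁ V₂ : WeierstrassCurve ℚ} (C : VariableChange ℚ)
    (hC : C • V₁ = V₂) {U₁ U₂ : WeierstrassCurve F} (h₁ : V₁.baseChange F = U₁)
    (h₂ : C.map (algebraMap ℚ F) • U₁ = U₂) (h₃ : V₂.baseChange F = U₂) (Q : V₁.toAffine.Point) :
    Affine.Point.congrEquiv h₂ (VariableChange.pointEquiv U₁ (C.map (algebraMap ℚ F))
        (Affine.Point.congrEquiv h₁ (Affine.Point.baseChange (W' := V₁) ℚ F Q))) =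
      Affine.Point.congrEquiv h₃ (Affine.Point.baseChange (W' := V₂) ℚ F
        (Affine.Point.congrEquiv hC (VariableChange.pointEquiv V₁ C Q))) := by
  subst h₁ h₃
  rcases Q with _ | ⟨x, y, h⟩
  · show Affine.Point.congrEquiv h₂ (VariableChange.pointEquiv _ _
        (Affine.Point.congrEquiv _ (Affine.Point.baseChange (W' := V₁) ℚ F 0))) =
      Affine.Point.congrEquiv _ (Affine.Point.baseChange (W' := V₂) ℚ F
        (Affine.Point.congrEquiv hC (VariableChange.pointEquiv V₁ C 0)))
    simp only [map_zero]
    show (0 : _) = Affine.Point.congrEquiv _ (Affine.Point.baseChange (W' := V₂) ℚ F 0)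
    simp only [map_zero]
  · show Affine.Point.congrEquiv h₂ (VariableChange.pointEquiv _ _
        (Affine.Point.congrEquiv _ (.some (algebraMap ℚ F x) (algebraMap ℚ F y) _))) =
      Affine.Point.congrEquiv _ (Affine.Point.baseChange (W' := V₂) ℚ F
        (Affine.Point.congrEquiv hC (VariableChange.pointEquiv V₁ C (.some x y h))))
    rw [Affine.Point.congrEquiv_some, VariableChange.pointEquiv_some, Affine.Point.congrEquiv_some,
      VariableChange.pointEquiv_some, Affine.Point.congrEquiv_some]
    show _ = Affine.Point.congrEquiv _
      (Affine.Point.some (algebraMap ℚ F (C.toX x)) (algebraMap ℚ F (C.toY x y)) _)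
    rw [Affine.Point.congrEquiv_some]
    congr 1
    · simp only [VariableChange.toX_def, VariableChange.map, map_mul, map_pow, map_sub,
        Units.coe_map_inv, MonoidHom.coe_coe]
    · simp only [VariableChange.toY_def, VariableChange.map, map_mul, map_pow, map_sub,
        Units.coe_map_inv, MonoidHom.coe_coe]

/-- `Point.map` along an algebra isomorphism is onto (the inverse is `Point.map` along the inverse).
[folklore] -/
theorem map_algEquiv_surjective {F' : Type*} [Field F'] [Algebra ℚ F'] (e : F ≃ₐ[ℚ] F') :
    Function.Surjective (Affine.Point.map (W' := W) (e : F →ₐ[ℚ] F')) := by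
  intro P
  refine ⟨Affine.Point.map (W' := W) (e.symm : F' →ₐ[ℚ] F) P, ?_⟩
  rw [Affine.Point.map_map]
  rcases P with _ | ⟨x, y, h⟩
  · rfl
  · simp only [Affine.Point.map_some, AlgHom.coe_comp, Function.comp_apply]
    congr 1 <;> exact e.apply_symm_apply _

end Points

end Summit.BirchSwinnertonDyer.BirchSwinnertonDyer.Theorems.RamifiedSevenEllipticUnits.KummerCore

end
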